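import Summits.BirchSwinnertonDyer.BirchSwinnertonDyer.Theorems.CMKolyvaginAtInertTwoRationalDescentAtTwoPrimeDiscr
import Summits.BirchSwinnertonDyer.BirchSwinnertonDyer.Theorems.CMKolyvaginAtInertTwoRationalDescentAtTwoReciprocity
import Summits.BirchSwinnertonDyer.BirchSwinnertonDyer.Theorems.CMKolyvaginAtInertTwoRationalDescentAtTwoTower
import Summits.BirchSwinnertonDyer.BirchSwinnertonDyer.Theorems.GenusKolyvaginAtTwoEquivariantKolyvaginExactAtTwoLocalTorsionCount
import Literature.NumberTheory.EllipticCurves.SelmerCorankControlRatProofs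
import Summits.BirchSwinnertonDyer.Rank1Residual.GaloisImage.PropagatedConditionCardEP
import HarnessLib

/-!
# Route `CMKolyvaginAtInertTwo`, crux `CMKolyvaginExactAtInertTwo` (stmt-BirchSwinnertonDyer-24277):
# the binder (dual) DISCHARGED from the second bit — the `M₀ = 0` case on H₂ for a prime Heegner field
# modulo two Poitou–Tate print facts and TWO PLUMBING binders (tower), (desc-fin) only

Seat `bsd-line-cmk2-p1` g8 (cell `bsd-print-cf2`); helper (`--supports stmt-BirchSwinnertonDyer-24277`);
ninth file of the over-`ℚ` bit. THEOREMS ONLY; no item is closed; BSD is not proved by this.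

* `ratDescent_dual_of_plumbing` — the binder (dual) of `…PrimeDiscr.selmer_two_eq_zero_or_eq_kummer_of_cmInert_prime_discr`
  from `…Reciprocity.torsionLocalKer_of_reciprocity_rat` (THE SECOND BIT, Poitou–Tate over `ℚ`), given the
  two plumbing binders: (tower) `ξ ∈ torsionLocalKer_ℚ(w ∩ ℚ) ⟹ res ξ ∈ torsionLocalKer_K(w)`;
  (desc-fin) at a finite place `v ≠ u` of `ℚ`, a class whose restriction satisfies the Selmer condition
  at every place of `K` over `v` satisfies it at `v`. Ingredients: the descent `κ` of the `τ`-invariant class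
  `d` (`exists_resTorsion_two_eq_of_conjAct_eq`, p629049), `κ` not Selmer at `ℓ` (`…Tower`, p632224),
  `κ` Selmer off `{ℓ, q}` ((desc-fin) at finite places, `ArchVanishing` at `∞`), `#E(ℚ_ℓ)[2] = 2` at a
  Kolyvagin prime (gk2-p3 `GenusExact.ReductionCyclic.natCard_ker_zsmul_adicCompletion_two_eq`), `(ℓ) ≠ (q)`.
* `selmer_two_eq_zero_or_eq_kummer_of_cmInert_prime_discr_of_plumbing` — **ON H₂ with `K = ℚ(√−q)` a
  prime Heegner field: `y_K ∉ 2E(K)` ⟹ `Sel₂(E/K) ⊆ {0, δ₂ y_K}`**, modulo exactly: the PRINT fact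
  `poitouTate_selmerStructure_duality_real ℚ` (Milne ADT I.4.10; Tate's local Euler–Poincaré characteristic
  is the tree's THEOREM `GaloisImage.EP.localEulerPoincareCharacteristic_adicCompletion`), `chebotarev_artinRep`
  (inside g3's leaf), ty2's `p = 2` Kolyvagin data `D`, `R`, and the plumbing binders (tower), (desc-fin).

References: [GrossLMS1991] §§5–6, §10; [McCallumLMS1991] §§2–3, §5; [MilneADT2006] I Thm. 2.8, Cor. 3.4,
Prop. 3.8, Thm. 4.10; [Kolyvagin1989Izv] §3.
-/

-- single-conjunct summit: `Summit.BirchSwinnertonDyer.BirchSwinnertonDyer.…` repeats the name by design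
set_option linter.dupNamespace false
set_option autoImplicit false

noncomputable section

open scoped Classical
open WeierstrassCurve NumberField IsDedekindDomain Field
open Literature.NumberTheory.GaloisRepresentations Literature.NumberTheory.EllipticCurves
open Literature.NumberTheory.GaloisCohomology
open Rat.HeightOneSpectrum (primesEquiv)

namespace Summit.BirchSwinnertonDyer.BirchSwinnertonDyer.Theorems.KolyvaginRatDescentTwo

variable (W : WeierstrassCurve ℚ) {K : Type} [Field K] [NumberField K]

/-- **(dual) from the second bit and the two plumbing binders** (see the module docstring).
[cite: MilneADT2006, Ch. I, Cor. 3.4, Thm. 4.10 and Lemma 6.15] [cite: McCallumLMS1991, §2 Prop. 2.2, §3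
(3), §5 Lemma 5.3] [cite: GrossLMS1991, §3 (3.2) and Prop. 6.2] -/
theorem ratDescent_dual_of_plumbing [W.IsElliptic] [W.IsGloballyMinimal] (hsurj : W.HasSurjectiveModNGaloisRep 2)
    (hΔ : W.Δ < 0) (hK : IsImaginaryQuadratic K) {c : K ≃ₐ[ℚ] K} (hc : c ≠ 1)
    (hPT : poitouTate_selmerStructure_duality_real ℚ)
    (hEP : ∀ v : HeightOneSpectrum (𝓞 ℚ), localEulerPoincareCharacteristic (v.adicCompletion ℚ))
    {q : ℕ} (hd : discr K = -(q : ℤ)) (u : HeightOneSpectrum (𝓞 ℚ))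
    (hu : ((primesEquiv u : Nat.Primes) : ℕ) = q)
    (htower : ∀ (w : HeightOneSpectrum (𝓞 K)) (ξ : galH1Torsion W ((2 ^ 1 : ℕ) : ℤ)),
      ξ ∈ W.torsionLocalKer ((w.under (𝓞 ℚ)).adicCompletion ℚ) ((2 ^ 1 : ℕ) : ℤ) →
        resTorsion W K ((2 ^ 1 : ℕ) : ℤ) ξ ∈
          (W.baseChange K).torsionLocalKer (w.adicCompletion K) ((2 ^ 1 : ℕ) : ℤ))
    (hdescfin : ∀ (ξ : galH1Torsion W ((2 ^ 1 : ℕ) : ℤ)) (v : HeightOneSpectrum (𝓞 ℚ)), v ≠ u →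
      (∀ w : HeightOneSpectrum (𝓞 K), w.under (𝓞 ℚ) = v →
        resTorsion W K ((2 ^ 1 : ℕ) : ℤ) ξ ∈
          selmerLocalKer (W.baseChange K) (w.adicCompletion K) ((2 ^ 1 : ℕ) : ℤ)) →
      ξ ∈ selmerLocalKer W (v.adicCompletion ℚ) ((2 ^ 1 : ℕ) : ℤ)) :
    ∀ {ℓ : ℕ} (hℓ : IsKolyvaginPrime (W.conductorNorm ℤ) W K 2 ℓ),
      FrobEqFrobInfty W K (2 ^ 1) ℓ →
      ∀ d : galH1Torsion (W.baseChange K) ((2 ^ 1 : ℕ) : ℤ), conjAct W c ((2 ^ 1 : ℕ) : ℤ) d = d →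
      (∀ v : HeightOneSpectrum (𝓞 K), (ℓ : 𝓞 K) ∉ v.asIdeal →
        d ∈ selmerLocalKer (W.baseChange K) (v.adicCompletion K) ((2 ^ 1 : ℕ) : ℤ)) →
      (∀ w : InfinitePlace K, d ∈ selmerLocalKer (W.baseChange K) w.Completion ((2 ^ 1 : ℕ) : ℤ)) →
      d ∉ selmerLocalKer (W.baseChange K) (hℓ.place.adicCompletion K) ((2 ^ 1 : ℕ) : ℤ) →
      ∀ ξ : galH1Torsion W ((2 ^ 1 : ℕ) : ℤ),
      ((∀ v : HeightOneSpectrum (𝓞 ℚ), v ≠ u →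
          ξ ∈ selmerLocalKer W (v.adicCompletion ℚ) ((2 ^ 1 : ℕ) : ℤ)) ∧
          ∀ w : InfinitePlace ℚ, ξ ∈ selmerLocalKer W w.Completion ((2 ^ 1 : ℕ) : ℤ)) →
      ξ ∈ W.torsionLocalKer (u.adicCompletion ℚ) ((2 ^ 1 : ℕ) : ℤ) →
      resTorsion W K ((2 ^ 1 : ℕ) : ℤ) ξ ∈
        (W.baseChange K).torsionLocalKer (hℓ.place.adicCompletion K) ((2 ^ 1 : ℕ) : ℤ) := by
  intro ℓ hℓ hF d hτd hdsel _hdinf hdlam ξ hξ hξu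
  haveI : Fact ℓ.Prime := ⟨hℓ.prime⟩
  have hℓp : ℓ.Prime := hℓ.prime
  have hℓN : ¬ ℓ ∣ W.conductorNorm ℤ := hℓ.2.1
  have hℓD : ¬ (ℓ : ℤ) ∣ discr K := hℓ.2.2.1
  have hℓ2 : ℓ ≠ 2 := hℓ.2.2.2.1
  -- the place `vℓ` of `ℚ` under `λ = hℓ.place`
  let lamK : HeightOneSpectrum (𝓞 K) := hℓ.place
  let vℓ : HeightOneSpectrum (𝓞 ℚ) := lamK.under (𝓞 ℚ)
  have hℓvℓ : (ℓ : 𝓞 ℚ) ∈ vℓ.asIdeal := by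
    change (ℓ : 𝓞 ℚ) ∈ (lamK.asIdeal.comap (algebraMap (𝓞 ℚ) (𝓞 K)))
    rw [Ideal.mem_comap, map_natCast]
    exact hℓ.mem_place
  have hvℓeq : ((primesEquiv vℓ : Nat.Primes) : ℕ) = ℓ := primesEquiv_eq_of_natCast_mem hℓp hℓvℓ
  -- `vℓ ≠ u` (ℓ ∤ d_K = −q), `2 ∉ vℓ` (ℓ ≠ 2)
  have hvu : vℓ ≠ u := by
    intro h
    have hℓq : ℓ = q := by rw [← hvℓeq, h, hu]
    exact hℓD ⟨-1, by rw [hd, hℓq]; ring⟩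
  have h2v : ((2 : ℕ) : 𝓞 ℚ) ∉ vℓ.asIdeal := fun h2 ↦
    hℓ2 (hvℓeq.symm.trans (primesEquiv_eq_of_natCast_mem Nat.prime_two h2))
  -- `#E(ℚ_ℓ)[2] = 2` at the Kolyvagin prime (gk2-p3)
  have hgood : W.HasGoodReductionAt vℓ := by
    by_contra h
    exact hℓN (hvℓeq ▸ (W.dvd_conductorNorm_iff vℓ).mpr h)
  have hgoodℓ : W.HasGoodReductionAtPrime ℓ :=
    (hasGoodReductionAtPrime_primesEquiv_iff_holds W vℓ ℓ hvℓeq).mpr hgood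
  have ht : Nat.card (nsmulAddMonoidHom 2 :
      (W.baseChange (vℓ.adicCompletion ℚ)).toAffine.Point →+ _).ker = 2 := by
    rw [← zsmulAddGroupHom_natCast]
    exact GenusExact.ReductionCyclic.natCard_ker_zsmul_adicCompletion_two_eq W hΔ hℓ2 hgoodℓ hF hℓvℓ
  -- the descent `κ` of `d` and its local behaviour over `ℚ`
  obtain ⟨κ, hκ⟩ : ∃ κ : galH1Torsion W ((2 ^ 1 : ℕ) : ℤ), resTorsion W K ((2 ^ 1 : ℕ) : ℤ) κ = d :=
    exists_resTorsion_two_eq_of_conjAct_eq K W hsurj hK hc hτd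
  have hκv : κ ∉ selmerLocalKer W (vℓ.adicCompletion ℚ) ((2 ^ 1 : ℕ) : ℤ) :=
    not_mem_selmerLocalKer_of_resTorsion_not_mem K W _ lamK (by rw [hκ]; exact hdlam)
  have hκfin : ∀ v' : HeightOneSpectrum (𝓞 ℚ), v' ≠ vℓ → v' ≠ u →
      κ ∈ selmerLocalKer W (v'.adicCompletion ℚ) ((2 ^ 1 : ℕ) : ℤ) := by
    intro v' hv'ℓ hv'u
    refine hdescfin κ v' hv'u fun w hw ↦ ?_
    rw [hκ]
    refine hdsel w fun hℓw ↦ hv'ℓ ?_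
    -- `ℓ ∈ w` forces `w ∩ ℚ ∋ ℓ`, i.e. `v' = vℓ`
    have hℓv' : (ℓ : 𝓞 ℚ) ∈ v'.asIdeal := by
      rw [← hw]
      change (ℓ : 𝓞 ℚ) ∈ (w.asIdeal.comap (algebraMap (𝓞 ℚ) (𝓞 K)))
      rw [Ideal.mem_comap, map_natCast]
      exact hℓw
    apply primesEquiv.injective
    apply Subtype.ext
    rw [primesEquiv_eq_of_natCast_mem hℓp hℓv', hvℓeq]
  have hκinf : ∀ w : InfinitePlace ℚ, κ ∈ selmerLocalKer W w.Completion ((2 ^ 1 : ℕ) : ℤ) :=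
    fun w ↦ mem_selmerLocalKer_infinitePlace_of_Δ_neg W hΔ w κ
  -- THE SECOND BIT over `ℚ` at `vℓ` (level `2 = 2 ^ 1` definitionally), then (tower)
  have hξ' : (∀ v' : HeightOneSpectrum (𝓞 ℚ), v' ≠ u →
        ξ ∈ selmerLocalKer W (v'.adicCompletion ℚ) ((2 : ℕ) : ℤ)) ∧
      ∀ w : InfinitePlace ℚ, ξ ∈ selmerLocalKer W w.Completion ((2 : ℕ) : ℤ) := hξ
  have hξu' : ξ ∈ W.torsionLocalKer (u.adicCompletion ℚ) ((2 : ℕ) : ℤ) := hξu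
  have hκ' : (∀ v' : HeightOneSpectrum (𝓞 ℚ), v' ≠ vℓ → v' ≠ u →
        κ ∈ selmerLocalKer W (v'.adicCompletion ℚ) ((2 : ℕ) : ℤ)) ∧
      ∀ w : InfinitePlace ℚ, κ ∈ selmerLocalKer W w.Completion ((2 : ℕ) : ℤ) := ⟨hκfin, hκinf⟩
  have hκv' : κ ∉ selmerLocalKer W (vℓ.adicCompletion ℚ) ((2 : ℕ) : ℤ) := hκv
  have hξvℓ : ξ ∈ W.torsionLocalKer (vℓ.adicCompletion ℚ) ((2 ^ 1 : ℕ) : ℤ) :=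
    torsionLocalKer_of_reciprocity_rat W hPT (hEP vℓ) hvu h2v ht hξ' hξu' hκ' hκv'
  exact htower lamK ξ hξvℓ

/-- **ON H₂ with a prime Heegner field: `y_K ∉ 2E(K)` ⟹ `Sel₂(E/K) ⊆ {0, δ₂ y_K}` modulo the two
Poitou–Tate print fact and the two PLUMBING binders (tower), (desc-fin) only** — `…PrimeDiscr` with
(dual) discharged by `ratDescent_dual_of_plumbing` and (desc-fin) in the place-over form. Consequently
`Ш(E/K)[2] = 0`, `#Ш(E/K)[2^∞] = 4⁰`: the `M₀ = 0` case of the crux for `K = ℚ(√−q)`.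
[cite: GrossLMS1991, Prop. 2.1 with §10, Props. 5.4, 6.2] [cite: McCallumLMS1991, §2 Prop. 2.2, §3
Cor. 3.2, §5 Lemma 5.3] [cite: MilneADT2006, Ch. I, Thm. 2.8 and Thm. 4.10] [cite: Kolyvagin1989Izv, §3] -/
theorem selmer_two_eq_zero_or_eq_kummer_of_cmInert_prime_discr_of_plumbing [W.IsElliptic]
    [W.IsGloballyMinimal] [NeZero (W.conductorNorm ℤ)] (hCM : W.HasCM)
    (hin : Literature.NumberTheory.EllipticCurves.Rank1Residual.CMInert W 2)
    (hsurj : W.HasSurjectiveModNGaloisRep 2) (hK : IsImaginaryQuadratic K) (hodd : Odd (discr K))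
    (hH : SatisfiesHeegnerHypothesis (W.conductorNorm ℤ) K) {q : ℕ} (hq : q.Prime)
    (hd : discr K = -(q : ℤ)) (u : HeightOneSpectrum (𝓞 ℚ)) (hu : ((primesEquiv u : Nat.Primes) : ℕ) = q)
    (hPT : poitouTate_selmerStructure_duality_real ℚ)
    {P : (W.baseChange K).toAffine.Point} (hP : IsHeegnerPoint (W.conductorNorm ℤ) W K P)
    {c : K ≃ₐ[ℚ] K} (hc : c ≠ 1) (hy : ∀ Q : (W.baseChange K).toAffine.Point, 2 • Q ≠ P)
    (D : Rank1Residual.P2.KolyvaginMachine.PointSystemFamily (W.conductorNorm ℤ) W K P 2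
      (Literature.NumberTheory.EllipticCurves.Rank1Residual.CMInert W))
    (R : Rank1Residual.P2.KolyvaginMachine.ReciprocityFamily (W.conductorNorm ℤ) W K 2
      (Literature.NumberTheory.EllipticCurves.Rank1Residual.CMInert W))
    (hdiv : ∀ Q : geomPoints (W.baseChange K), ∃ R, ((2 ^ 1 : ℕ) : ℤ) • R = Q)
    (htower : ∀ (w : HeightOneSpectrum (𝓞 K)) (ξ : galH1Torsion W ((2 ^ 1 : ℕ) : ℤ)),
      ξ ∈ W.torsionLocalKer ((w.under (𝓞 ℚ)).adicCompletion ℚ) ((2 ^ 1 : ℕ) : ℤ) →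
        resTorsion W K ((2 ^ 1 : ℕ) : ℤ) ξ ∈
          (W.baseChange K).torsionLocalKer (w.adicCompletion K) ((2 ^ 1 : ℕ) : ℤ))
    (hdescfin : ∀ (ξ : galH1Torsion W ((2 ^ 1 : ℕ) : ℤ)) (v : HeightOneSpectrum (𝓞 ℚ)), v ≠ u →
      (∀ w : HeightOneSpectrum (𝓞 K), w.under (𝓞 ℚ) = v →
        resTorsion W K ((2 ^ 1 : ℕ) : ℤ) ξ ∈
          selmerLocalKer (W.baseChange K) (w.adicCompletion K) ((2 ^ 1 : ℕ) : ℤ)) →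
      ξ ∈ selmerLocalKer W (v.adicCompletion ℚ) ((2 ^ 1 : ℕ) : ℤ)) :
    ∀ s ∈ selmerGroup (W.baseChange K) ((2 ^ 1 : ℕ) : ℤ),
      s = 0 ∨ s = kummerMapTorsion (W.baseChange K) ((2 ^ 1 : ℕ) : ℤ) hdiv P := by
  have hΔ : W.Δ < 0 := KolyvaginEigenTwo.Δ_neg_of_cmInert_two W hCM hin hsurj
  -- Tate's local Euler–Poincaré characteristic is a THEOREM of the tree at every finite place of `ℚ`
  have hEP : ∀ v : HeightOneSpectrum (𝓞 ℚ), localEulerPoincareCharacteristic (v.adicCompletion ℚ) :=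
    fun v ↦ Rank1Residual.GaloisImage.EP.localEulerPoincareCharacteristic_adicCompletion ℚ v
  refine selmer_two_eq_zero_or_eq_kummer_of_cmInert_prime_discr W hCM hin hsurj hK hodd hH hq hd u hu hPT
    hEP hP hc hy D R hdiv ?_ (ratDescent_dual_of_plumbing W hsurj hΔ hK hc hPT hEP hd u hu htower hdescfin)
  -- (desc-fin) in the form `…PrimeDiscr` consumes
  intro s hs ξ hξ v hv
  refine hdescfin ξ v hv fun w _ ↦ ?_
  rw [hξ]
  exact ((mem_selmerGroup_iff (W.baseChange K) _ s).mp hs).1 w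

end Summit.BirchSwinnertonDyer.BirchSwinnertonDyer.Theorems.KolyvaginRatDescentTwo

end
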